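/- Copyright: the b2b-balaban cell (near-miss cell 7), T⁴-continuum fan-out, row-NE7b OWNER lineage `t4-ne7b-p1`
(gen 100) — (α)-instance, (A3) module J3, PART B: the PRINTED VALUATIONS of the count road's sharp-exponent letters
([Balaban1989LargeFieldII] (1.79) p. 383 face values, (1.89) p. 387) and what M5-3's rounding junction makes of them
(refuter recommendation R-g54-1, PRICING-NE7b v51 F286 (v); located owner finding F-ne7bp1-g100-1).  OWNER SKETCH —
candidate bytes for INTERFACE REQUEST NE7b IR-100-1 (B); independent of J2b.  Released under the licence of the
surrounding project. -/
import Summits.QuantumFields.BalabanUV.T4Continuum.Support.HistoryBankingDiscountCharge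
import Literature.MathematicalPhysics.QuantumFieldTheory.Balaban1983to89.B16LargeFieldFactors380

/-!
# (α)-INSTANCE, (A3) module J3, PART B — the PRINTED VALUATIONS of the exponent letters `sB`, `sR` of the pinned
per-step display (PART A, `B16HistoryStepDisplayPinned`) and of M5-3's `FactorRead` ∕ `RoundingRoom`, and two junction
facts: NO ROOM AT (1.79)'s FACE VALUE; the (1.89) renewal clause as an inequality between letters

Summits-side support sketch of the T⁴-continuum cell (rung (B)+1 on a FINITE torus only; NOT infinite volume, NOT
the mass gap, NOT Clay; NOT a proof of NE7b — the cell's OWN estimate `T4WeightBudget.RelWeightBound`, NOT PRINTED,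
NOT PROVED).  [folklore] real arithmetic over M5-3 (`HistoryBankingDiscountCharge.RoundingRoom`, `dshare`, `mshare`,
`dshare_nonneg`) and the cell's letter tables (`HistoryConstants.PrintedO1s`, `pcredit`, `pcredit_kind0∕1`,
`PrintedO1s.surplus`, `p0Profile`); nothing printed is asserted, no `def … : Prop`, no cite-tagged hypothesis, zero
`sorry`; §3 cites lit-balaban's PROVED arithmetic of pp. 380–381 (`Literature.…B16LargeFieldFactors380`: `minConst`,
`display381`, `min_eq_A1sq`) BY NAME.  [Balaban1989LargeFieldII] p. 380 (the three characteristic-function factors),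
p. 381 l. 1–4 and its display, p. 383 l. 14–17 and (1.79), p. 386 l. 1, (1.85)–(1.88), (1.89) p. 387 are LOCATORS only.

WHAT.  PART A pins J2b's per-step display IN SHAPE: birth factors `exp(−sB K ℓ d′)`, renewal factors `exp(−sR K h)` —
`sB`, `sR` the SAME sharp-exponent letters M5-3's `FactorRead` (then `rfl`) and `RoundingRoom` consume.  Here: §1 the
PRINTED VALUATIONS of those letters as abbreviations over the cell's tables — the FACE values of (1.79) p. 383 (births
`½γ₀A₁²p₀(g_ℓ)²(d′+1) + 2p₀(g_ℓ)` = p. 381 l. 1–2's displayed estimate; renewals `p₀(g_h)` = p. 383 l. 17 ∕ p. 386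
l. 1), which ARE the count road's booked credits `pcredit` BY NAME (`sBface`, `sRface`, `pcredit_eq_sBface_of_kind0`,
`pcredit_eq_sRface_of_kind1`), and the (1.89) p. 387 value `2(1+β₀)⁻¹p₀(g_h)` for the operation of a renewed region
(`sR189` = the cell's merger-surplus letter `PrintedO1s.surplus`, (1.87)); §2 TWO JUNCTION FACTS: (F1) **AT FACE VALUE
M5-3's `RoundingRoom` LEAVES NO ROOM** — with `sB := sBface` its birth clause «booked credit + own share + one merger
share ≤ sharp exponent» forces `dshare e + mshare s ≤ 0` after every birth (`roundingRoom_face_noRoom`), hence is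
FALSE as soon as one merger share is positive (`not_roundingRoom_face`; shares are non-negative for `E₂, E₃ ≥ 0`);
(F2) **AT THE (1.89) VALUE THE RENEWAL CLAUSE IS A NEEDS-CONSTANT-SHAPED INEQUALITY** `dshare e ≤ (2(1+β₀)⁻¹ −
1)·p₀(g_{step−1})` for every performed renewal (`roundingRoom_renew_189`, converse `renew_clause_of_189`); §3 THE
SHARP PRINTED VALUATION OF THE BIRTH LETTER = p. 381's display, LEFT member `γ₀·min{½B₃⁻²A₀², 2A₁², A₁²}·p₀(g_ℓ)²·(d′+1)`
(`sB380`, over lit-balaban's `minConst`) — the per-component product of p. 380's three raw factors BEFORE «can be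
estimated by» —, `sBface_le_sB380` (face ≤ sharp = `display381` read on the letters, under `2B₃²A₁² ≤ A₀²` and
`4 ≤ γ₀A₁²p₀(g_ℓ)`), the ROOM `sB380 − sBface = ½γ₀A₁²p₀(g_ℓ)²(d′+1) − 2p₀(g_ℓ)` (`sB380_sub_sBface`), and (F3) **AT THE
SHARP VALUE THE BIRTH CLAUSE IS A NEEDS-CONSTANT-SHAPED INEQUALITY** `dshare e + mshare s ≤ ½γ₀A₁²p₀(g_ℓ)²(d′+1) −
2p₀(g_ℓ)` (`roundingRoom_birth_380`, converse `birth_clause_of_380`); §4 THE SHARP PRINTED VALUATION OF THE RENEWAL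
LETTER = p. 383's «largest factor» after (1.78), `R(g_h)^{−(d+5)}·p₁(g_h)²` (`sRprep`, the exponent of IR-100-2's conjunct
(P); lit-balaban's `B16Sect1Kernels.lfFactor178` ∕ `ExponentProviso383`), `sRface_le_sRprep` (face ≤ sharp GIVEN the p. 383
rounding `exp(−R^{−(d+5)}p₁²) ≤ exp(−p₀)` = `exp_lfFactor_le_exp_neg_p0`'s conclusion), and (F4) **`roundingRoom_renew_prep`**:
at that value the renewal clause is `dshare e ≤ R(g_h)^{−(d+5)}p₁(g_h)² − p₀(g_h)` (converse `renew_clause_of_prep`).  LOCATED POINT for (A1c) ∕ the M5-3 junction ∕ the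
refuter ∕ calc (owner finding F-ne7bp1-g100-1, zero weight on any verdict): the count road's birth letter must be read
at p. 381's LEFT member (or sharper), never at (1.79)'s face value; print leaves the room `½γ₀A₁²p₀²(d′+1) − 2p₀` per
birth and `R(g_h)^{−(d+5)}p₁(g_h)² − p₀(g_h)` per renewal (p. 383; or `(1−β₀)(1+β₀)⁻¹p₀` at the (1.89) reading), and whether the cell's shares `dshare`∕`mshare` (polynomial in
`L·R_s`, window lengths, `E₃∕E₂`) fit in them along the flow is an exponent-window question of print's own kind («2p₁ −
(d+5)r₀ > p₀», p. 383) — the first two NEEDS-CONSTANT-shaped lines of this row (NOT written: no letter is valued here).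

NOT HERE (honest).  Any value of any letter; which valuation (A1c) inhabits; M5; any estimate.  BY-NAME EFFECT ON THE
WALL (`WALL-NE7b-P1.md` §2): NONE (facts about the cell's own letters).  HONEST DEPENDENCY (cell): continuum YM on T⁴
⇐ BetaPertH ∧ nine spine estimates (0/9 proved); BetaPertH ⇐ (D1) ∧ (D4) ∧ CAP+tail; G-an2-4 gates asym, D1 and
NE2/3/4.  This file changes none of it.
-/

open Finset
open Literature.MathematicalPhysics.QuantumFieldTheory.Balaban1983to89
open Literature.MathematicalPhysics.QuantumFieldTheory.Balaban1983to89.T4PersistenceDictionary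

namespace Summit.QuantumFields.BalabanUV.T4Continuum.B16HistoryStepDisplayValuations

open Summit.QuantumFields.BalabanUV.T4Continuum.HistoryBankingDiscountCharge
open Summit.QuantumFields.BalabanUV.T4Continuum.HistoryConstants
open Literature.MathematicalPhysics.QuantumFieldTheory.Balaban1983to89.B16LargeFieldFactors380

noncomputable section

/-! ## §1 The PRINTED VALUATIONS of the exponent letters (abbreviations over the cell's letter tables; locators only) -/

section Valuations

variable (O : PrintedO1s) (C : T4PrintedShapeBanking.Consts) (g : ℕ → ℕ → ℝ)

/-- **THE FACE VALUE OF THE BIRTH EXPONENT, (1.79) p. 383 ∕ p. 381 l. 1–2**: `½γ₀A₁²p₀(g_ℓ)²(d′ + 1) + 2p₀(g_ℓ)` at the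
flow `g K` of run `K` — BY NAME the count road's booked birth credit `pcredit O C (g K) (ℓ, 0, d′)`
(`HistoryConstants.pcredit_kind0`).  *"For each component the above large field factors yield an exponential factor,
which can be estimated by"* this (p. 381 l. 1–2): a printed ESTIMATE of p. 380's raw characteristic-function factors,
not those factors.  An abbreviation. [folklore] -/
def sBface (K ℓ d' : ℕ) : ℝ := pcredit O C (g K) ((ℓ, 0, d') : PEv)

/-- **THE FACE VALUE OF THE RENEWAL EXPONENT, (1.79)'s Π′ ∕ p. 383 l. 17 ∕ p. 386 l. 1**: `p₀(g_h)` for the level-`h`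
𝐑-operation — BY NAME the booked renewal credit `pcredit O C (g K) (h + 1, 1, 0)` (`pcredit_kind1`; *"we estimate the
factors by exp(−p₀(g_j))"*, p. 383 l. 17 — again a printed estimate, of the preparatory factor of l. 14–16 under the
proviso «2p₁ − (d+5)r₀ > p₀»).  An abbreviation. [folklore] -/
def sRface (K h : ℕ) : ℝ := pcredit O C (g K) ((h + 1, 1, 0) : PEv)

/-- **THE (1.89) VALUE OF THE RENEWAL EXPONENT, p. 387**: `2(1+β₀)⁻¹p₀(g_h)` — *"the fundamental inequality
𝐓_k(X)1 ≤ exp(−2(1+β₀)⁻¹p₀(g_k))"* (1.89) read for the operation of a renewed region (refuter R-g54-1: «(1.89) per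
RENEWING OPERATION»); BY NAME the cell's merger-surplus letter `PrintedO1s.surplus` at `p₀(g_h)` ((1.87)).  An
abbreviation; whether the renewal factor of the count road may be read at this value is (A1c)'s. [folklore] -/
def sR189 (K h : ℕ) : ℝ := O.surplus (p0Profile C.A₀ C.p₀ (g K h))

/-- the face birth exponent, unfolded (`pcredit_kind0`) [folklore] -/
theorem sBface_eq (K ℓ d' : ℕ) :
    sBface O C g K ℓ d' =
      O.γ₀ * O.A₁ ^ 2 / 2 * p0Profile C.A₀ C.p₀ (g K ℓ) ^ 2 * ((d' : ℝ) + 1) + 2 * p0Profile C.A₀ C.p₀ (g K ℓ) := by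
  unfold sBface
  rw [pcredit_kind0 (by rfl), PEv.step_mk, PEv.fat_mk]

/-- the face renewal exponent, unfolded (`pcredit_kind1`) [folklore] -/
theorem sRface_eq (K h : ℕ) : sRface O C g K h = p0Profile C.A₀ C.p₀ (g K h) := by
  unfold sRface
  rw [pcredit_kind1 (by rfl), PEv.step_mk, Nat.add_sub_cancel]

/-- the (1.89) renewal exponent, unfolded [folklore] -/
theorem sR189_eq (K h : ℕ) : sR189 O C g K h = 2 * (1 + O.β₀)⁻¹ * p0Profile C.A₀ C.p₀ (g K h) := rfl

/-- **THE BOOKED CREDIT OF ANY BIRTH EVENT IS THE FACE VALUE AT ITS STEP AND CLASS** (an event is read only through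
`step ∕ kind ∕ fat`). [folklore] -/
theorem pcredit_eq_sBface_of_kind0 (K : ℕ) {e : PEv} (he : e.kind = 0) :
    pcredit O C (g K) e = sBface O C g K e.step e.fat := by
  unfold sBface
  rw [pcredit_kind0 he, pcredit_kind0 (by rfl)]
  simp only [PEv.step_mk, PEv.fat_mk]

/-- the booked credit of any renewal event is the face value of the renewing level `step − 1` (for a performed
renewal `step ≥ 1`; at `step = 0` both sides read level `0` by truncated subtraction) [folklore] -/
theorem pcredit_eq_sRface_of_kind1 (K : ℕ) {e : PEv} (he : e.kind = 1) :
    pcredit O C (g K) e = sRface O C g K (e.step - 1) := by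
  unfold sRface
  rw [pcredit_kind1 he, pcredit_kind1 (by rfl)]
  simp only [PEv.step_mk, Nat.add_sub_cancel]

end Valuations

/-! ## §2 What M5-3's rounding junction makes of the printed valuations (facts about letters; nothing of Bałaban's) -/

section Junction

variable (O : PrintedO1s) (C : T4PrintedShapeBanking.Consts) (g : ℕ → ℕ → ℝ) (L K : ℕ) (R : ℕ → ℕ)

/-- **AT FACE VALUE THE ROUNDING JUNCTION LEAVES NO ROOM**: if the sharp birth letter of run `K` is read AT (1.79)'s
face value (`sBface` = the booked credit itself), M5-3's `RoundingRoom.birth` — «booked credit + own share + one merger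
share ≤ sharp exponent» — forces `dshare e + mshare s ≤ 0` for every birth event `e` and every performed step `s` after
it.  (So the birth exponent the count road needs is strictly sharper than p. 381 l. 1–2's displayed estimate, or the
booked credit must sit below face value — PART A's Q-J3-2.) [folklore] -/
theorem roundingRoom_face_noRoom {sR : ℕ → ℝ} (h : RoundingRoom C O L K R (g K) (sBface O C g K) sR)
    (e : PEv) (he : e.kind = 0) (s : ℕ) (hes : e.step ≤ s) (hsK : s ≤ K) :
    dshare C L R e + mshare C L R s ≤ 0 := by
  have hb := h.birth e he s hes hsK
  rw [pcredit_eq_sBface_of_kind0 O C g K he] at hb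
  linarith

/-- **… HENCE FAILS AS SOON AS ONE MERGER SHARE IS POSITIVE** after some birth (shares are non-negative for
`E₂, E₃ ≥ 0`, `dshare_nonneg`): the face-value pinning of the birth letter is closed off for the count road.
[folklore] -/
theorem not_roundingRoom_face {sR : ℕ → ℝ} (hE₂ : 0 ≤ C.E₂) (hE₃ : 0 ≤ C.E₃) {e : PEv} (he : e.kind = 0) {s : ℕ}
    (hes : e.step ≤ s) (hsK : s ≤ K) (hm : 0 < mshare C L R s) :
    ¬ RoundingRoom C O L K R (g K) (sBface O C g K) sR := fun h => by
  have h0 := roundingRoom_face_noRoom O C g L K R h e he s hes hsK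
  have hd := dshare_nonneg (L := L) (R := R) hE₂ hE₃ e
  linarith

/-- **AT THE (1.89) VALUE THE RENEWAL CLAUSE IS A NEEDS-CONSTANT INEQUALITY**: with the renewal letter of run `K` read
at `2(1+β₀)⁻¹p₀(g_h)` (`sR189`), `RoundingRoom.renew` says exactly that every performed renewal's own share fits in the
room above the booked credit `p₀(g_h)`: `dshare e ≤ (2(1+β₀)⁻¹ − 1)·p₀(g_{step − 1})` — letters `E₂, E₃, n₁, q′, L, R_s`
of the share against `β₀, A₀, p₀` of the profile along the flow (NOT valued here). [folklore] -/
theorem roundingRoom_renew_189 {sB : ℕ → ℕ → ℝ} (h : RoundingRoom C O L K R (g K) sB (sR189 O C g K)) (e : PEv)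
    (he : e.kind = 1) (h1 : 1 ≤ e.step) (heK : e.step ≤ K) :
    dshare C L R e ≤ (2 * (1 + O.β₀)⁻¹ - 1) * p0Profile C.A₀ C.p₀ (g K (e.step - 1)) := by
  have hr := h.renew e he h1 heK
  rw [pcredit_kind1 he, sR189_eq] at hr
  linarith

/-- conversely, that inequality for every performed renewal IS the renewal clause at the (1.89) value (the birth clause
being a separate conjunct) [folklore] -/
theorem renew_clause_of_189 {e : PEv} (he : e.kind = 1)
    (hd : dshare C L R e ≤ (2 * (1 + O.β₀)⁻¹ - 1) * p0Profile C.A₀ C.p₀ (g K (e.step - 1))) :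
    pcredit O C (g K) e + dshare C L R e ≤ sR189 O C g K (e.step - 1) := by
  rw [pcredit_kind1 he, sR189_eq]
  linarith

end Junction

/-! ## §3 The SHARP printed valuation of the birth letter: p. 381's display, LEFT member (lit-balaban's
`B16LargeFieldFactors380.minConst`), and the room it leaves above the booked credit -/

section Sharp

variable (O : PrintedO1s) (C : T4PrintedShapeBanking.Consts) (B₃ : ℝ) (g : ℕ → ℕ → ℝ) (L K : ℕ) (R : ℕ → ℕ)

/-- **THE SHARP PRINTED VALUE OF THE BIRTH EXPONENT, p. 381 display, LEFT member** (render p027, typed and PROVED as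
arithmetic by lit-balaban in `B16LargeFieldFactors380`: `componentFactor_le`, `display381`): `γ₀·min{½B₃⁻²A₀², 2A₁²,
A₁²}·p₀(g_ℓ)²·(d′ + 1)` — the per-component product of p. 380's three characteristic-function factors BEFORE *"can be
estimated by"* rounds it to the face value `½γ₀A₁²p₀²(d′+1) + 2p₀`.  `B₃` = the constant of `ε_j`'s block norm ([III]);
`A₀` = `C.A₀` (the same printed `A₀` of `ε_j = g_jA₀p₀(g_j)` and of the profile).  An abbreviation over the cell's tables
and lit-balaban's `minConst`; nothing asserted. [folklore] -/
def sB380 (K ℓ d' : ℕ) : ℝ :=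
  O.γ₀ * minConst B₃ C.A₀ O.A₁ * p0Profile C.A₀ C.p₀ (g K ℓ) ^ 2 * ((d' : ℝ) + 1)

/-- **FACE ≤ SHARP — p. 381's display read on the letters** (`B16LargeFieldFactors380.display381`, by name): under the
constants-ledger relation `2B₃²A₁² ≤ A₀²` (so the minimum is `A₁²`), `γ₀ ≥ 0`, `p₀(g_ℓ) ≥ 0` and the printed smallness of
`g_ℓ` in the explicit form `4 ≤ γ₀A₁²p₀(g_ℓ)`, the booked birth credit is at most the sharp value. [folklore] -/
theorem sBface_le_sB380 (hB₃ : B₃ ≠ 0) (hγ : 0 ≤ O.γ₀) {K ℓ : ℕ} (hp : 0 ≤ p0Profile C.A₀ C.p₀ (g K ℓ))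
    (hR2 : 2 * B₃ ^ 2 * O.A₁ ^ 2 ≤ C.A₀ ^ 2) (hsmall : 4 ≤ O.γ₀ * O.A₁ ^ 2 * p0Profile C.A₀ C.p₀ (g K ℓ)) (d' : ℕ) :
    sBface O C g K ℓ d' ≤ sB380 O C B₃ g K ℓ d' := by
  have h := display381 (d' := (d' : ℝ)) hB₃ hγ hp (Nat.cast_nonneg d') hR2 hsmall
  rw [Real.exp_le_exp, neg_sub_left, neg_le_neg_iff] at h
  rw [sBface_eq]
  unfold sB380
  linarith

/-- **THE ROOM ABOVE THE BOOKED BIRTH CREDIT AT THE SHARP VALUE** when the minimum is `A₁²` (`2B₃²A₁² ≤ A₀²`,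
`B16LargeFieldFactors380.min_eq_A1sq`): `sB380 − sBface = ½γ₀A₁²p₀(g_ℓ)²(d′ + 1) − 2p₀(g_ℓ)`. [folklore] -/
theorem sB380_sub_sBface (hB₃ : B₃ ≠ 0) (hR2 : 2 * B₃ ^ 2 * O.A₁ ^ 2 ≤ C.A₀ ^ 2) (K ℓ d' : ℕ) :
    sB380 O C B₃ g K ℓ d' - sBface O C g K ℓ d' =
      O.γ₀ * O.A₁ ^ 2 / 2 * p0Profile C.A₀ C.p₀ (g K ℓ) ^ 2 * ((d' : ℝ) + 1) - 2 * p0Profile C.A₀ C.p₀ (g K ℓ) := by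
  unfold sB380
  rw [min_eq_A1sq hB₃ hR2, sBface_eq]
  ring

/-- **AT THE SHARP VALUE THE BIRTH CLAUSE IS A NEEDS-CONSTANT-SHAPED INEQUALITY**: with the birth letter of run `K` read
at p. 381's left member, M5-3's `RoundingRoom.birth` says exactly that every birth's own share plus one later merger share
fits in the room above the booked credit: `dshare e + mshare s ≤ sB380 − sBface` at the event's step and class — by
`sB380_sub_sBface`, `½γ₀A₁²p₀(g_ℓ)²(d′+1) − 2p₀(g_ℓ)` (letters `E₂, E₃, n₁, q′, L, R_s` of the shares against `γ₀, A₁, A₀,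
p₀` of the profile along the flow; NOT valued here). [folklore] -/
theorem roundingRoom_birth_380 {sR : ℕ → ℝ} (h : RoundingRoom C O L K R (g K) (sB380 O C B₃ g K) sR) (e : PEv)
    (he : e.kind = 0) (s : ℕ) (hes : e.step ≤ s) (hsK : s ≤ K) :
    dshare C L R e + mshare C L R s ≤ sB380 O C B₃ g K e.step e.fat - sBface O C g K e.step e.fat := by
  have hb := h.birth e he s hes hsK
  rw [pcredit_eq_sBface_of_kind0 O C g K he] at hb
  linarith

/-- conversely, that inequality for a birth and a later performed step IS the birth clause at the sharp value for them
[folklore] -/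
theorem birth_clause_of_380 {e : PEv} (he : e.kind = 0) {s : ℕ}
    (hd : dshare C L R e + mshare C L R s ≤ sB380 O C B₃ g K e.step e.fat - sBface O C g K e.step e.fat) :
    pcredit O C (g K) e + dshare C L R e + mshare C L R s ≤ sB380 O C B₃ g K e.step e.fat := by
  rw [pcredit_eq_sBface_of_kind0 O C g K he]
  linarith

end Sharp

/-! ## §4 The SHARP printed valuation of the renewal letter: p. 383's «largest factor» after (1.78) (lit-balaban's
`B16Sect1Kernels.lfFactor178` ∕ `ExponentProviso383` ∕ `exp_lfFactor_le_exp_neg_p0`; IR-100-2's conjunct (P)), and its room -/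

section SharpRenewal

variable (O : PrintedO1s) (C : T4PrintedShapeBanking.Consts) (Rprof P1prof : ℝ → ℝ) (dd : ℕ) (g : ℕ → ℕ → ℝ)
  (L K : ℕ) (R : ℕ → ℕ)

/-- **THE SHARP PRINTED VALUE OF THE RENEWAL EXPONENT, p. 383 after (1.78)** (render p029; typed by lit-balaban in
`B16Sect1Kernels`: `lfFactor178` *"… yield the following large field factor: exp(−½γ₀[6(d+3)(100M(L+1)N^{β₀}R_j)^{d+2}]⁻¹
A₁²p₁(g_j)) < exp(−R_j^{−d−5}p₁²(g_j)). This is the largest factor among all the small factors we have obtained from the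
large field characteristic functions in the preparatory steps"*): `R(g_h)^{−(d+5)}·p₁(g_h)²` for the level-`h` 𝐑-operation,
the profiles `R(g)` ([III] (2.5)) and `p₁(g)` ([III] (2.3)) read off the run's flow (IR-100-2's `Consts.R`∕`.P1`, its
conjunct (P)); print then *"estimate[s] the factors by exp(−p₀(g_j))"* under the proviso «2p₁ − (d+5)r₀ > p₀»
(`ExponentProviso383`) — the face value `sRface`.  An abbreviation; nothing asserted. [folklore] -/
def sRprep (K h : ℕ) : ℝ := (Rprof (g K h) ^ (dd + 5))⁻¹ * P1prof (g K h) ^ 2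

/-- **FACE ≤ SHARP FOR RENEWALS — p. 383's rounding read on the letters**: GIVEN the rounding
`exp(−R(g_h)^{−(d+5)}p₁(g_h)²) ≤ exp(−p₀(g_h))` (the conclusion of lit-balaban's `B16Sect1Kernels.exp_lfFactor_le_exp_neg_p0`
under `ExponentProviso383` in the `ℓ = log g_h⁻²` dictionary; IR-100-2's hypothesis `hround`), the booked renewal credit is at
most the sharp value. [folklore] -/
theorem sRface_le_sRprep {K h : ℕ}
    (hround : Real.exp (-sRprep Rprof P1prof dd g K h) ≤ Real.exp (-p0Profile C.A₀ C.p₀ (g K h))) :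
    sRface O C g K h ≤ sRprep Rprof P1prof dd g K h := by
  rw [Real.exp_le_exp, neg_le_neg_iff] at hround
  rw [sRface_eq]
  exact hround

/-- **AT THE SHARP PREPARATORY VALUE THE RENEWAL CLAUSE IS A NEEDS-CONSTANT-SHAPED INEQUALITY**: with the renewal letter of
run `K` read at p. 383's largest preparatory factor, M5-3's `RoundingRoom.renew` says exactly that every performed renewal's
own share fits in the room above the booked credit: `dshare e ≤ R(g_h)^{−(d+5)}p₁(g_h)² − p₀(g_h)`, `h = step − 1` (letters
`E₂, E₃, n₁, q′, L, R_s` of the share against the exponents `p₀, p₁, r₀` of the profiles — print's own window «2p₁ −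
(d+5)r₀ > p₀»; NOT valued here). [folklore] -/
theorem roundingRoom_renew_prep {sB : ℕ → ℕ → ℝ}
    (h : RoundingRoom C O L K R (g K) sB (sRprep Rprof P1prof dd g K)) (e : PEv) (he : e.kind = 1) (h1 : 1 ≤ e.step)
    (heK : e.step ≤ K) :
    dshare C L R e ≤ sRprep Rprof P1prof dd g K (e.step - 1) - p0Profile C.A₀ C.p₀ (g K (e.step - 1)) := by
  have hr := h.renew e he h1 heK
  rw [pcredit_kind1 he] at hr
  linarith

/-- conversely, that inequality for a performed renewal IS the renewal clause at the sharp preparatory value for it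
[folklore] -/
theorem renew_clause_of_prep {e : PEv} (he : e.kind = 1)
    (hd : dshare C L R e ≤ sRprep Rprof P1prof dd g K (e.step - 1) - p0Profile C.A₀ C.p₀ (g K (e.step - 1))) :
    pcredit O C (g K) e + dshare C L R e ≤ sRprep Rprof P1prof dd g K (e.step - 1) := by
  rw [pcredit_kind1 he]
  linarith

end SharpRenewal

/-! ## §5 (v1.1, append-only) AT (1.79)'s FACE VALUE THE JUNCTION FAILS OUTRIGHT — a birth's own share is at least `8`
(second reader leaf-03 g120's located sharpening S-1 of §2's `not_roundingRoom_face`, GAPS § C-ne7bleaf03g120-1;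
OWNER GO in advance l.47712 «statement exactly as in your probe, `[folklore]`, imports unchanged»).  [folklore]
arithmetic of the cell's OWN tables (`dictW`, `fatWait`, `dshare`, `mshare`, `T4PrintedShapeBanking.Consts.Valid`);
nothing of Bałaban's asserted. -/

section Outright

variable (O : PrintedO1s) (C : T4PrintedShapeBanking.Consts) (g : ℕ → ℕ → ℝ) (L K : ℕ) (R : ℕ → ℕ)

/-- a birth's window is at least `2`: `dictW R n₁ (s, 0, d′) = fatWait d′ + R s + 1` with `fatWait d′ = max 1 ⌊log₂ d′⌋
≥ 1`. [folklore] -/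
theorem two_le_dictW_birth (s d' : ℕ) : 2 ≤ dictW R C.n₁ ((s, 0, d') : PEv) := by
  rw [dictW_birth]
  have : 1 ≤ fatWait d' := le_max_left _ _
  omega

/-- **A BIRTH's OWN DISCOUNT SHARE IS AT LEAST `8`** (`E₂, E₃ ≥ 0`): the summand `4·W e` of `dshare` alone, `W e ≥ 2`;
the two `(L·R_s)^{q′}` summands are non-negative. [folklore] -/
theorem eight_le_dshare_birth (hE₂ : 0 ≤ C.E₂) (hE₃ : 0 ≤ C.E₃) (s d' : ℕ) :
    8 ≤ dshare C L R ((s, 0, d') : PEv) := by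
  have hW : (2 : ℝ) ≤ (dictW R C.n₁ ((s, 0, d') : PEv) : ℝ) := by exact_mod_cast two_le_dictW_birth C R s d'
  have hwt := T4PrintedShapeBanking.wt_nonneg C ((s, 0, d') : PEv)
  unfold dshare
  have h1 : 0 ≤ 8 * (dictW R C.n₁ ((s, 0, d') : PEv) : ℝ) * ((L : ℝ) * R (PEv.step (s, 0, d'))) ^ C.q' := by
    positivity
  have h2 : 0 ≤ 8 * (C.E₃ / C.E₂) *
      (((L : ℝ) * R (PEv.step (s, 0, d'))) ^ C.q' * T4PrintedShapeBanking.wt C (s, 0, d')) := by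
    positivity
  linarith

/-- **AT (1.79)'s FACE VALUE M5-3's ROUNDING JUNCTION FAILS OUTRIGHT** — the sharpening of `not_roundingRoom_face`: no
positive merger share is needed, the level-`0` birth `(0, 0, 0)` with `s := 0` already contradicts
`roundingRoom_face_noRoom`, its own share being `≥ 8 > 0 ≥ −mshare 0`.  Hypotheses: `E₂, E₃ ≥ 0` only (every `K`, `L`,
`R`, `g`, `O`, `sR`).  So F-ne7bp1-g100-1's face-value branch is closed for EVERY table, and the birth letter is read at
p. 381's left member (§3). [folklore] -/
theorem not_roundingRoom_face_outright {sR : ℕ → ℝ} (hE₂ : 0 ≤ C.E₂) (hE₃ : 0 ≤ C.E₃) :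
    ¬ RoundingRoom C O L K R (g K) (sBface O C g K) sR := fun h => by
  have h0 := roundingRoom_face_noRoom O C g L K R h ((0, 0, 0) : PEv) rfl 0 le_rfl (Nat.zero_le K)
  have hd := eight_le_dshare_birth C L R hE₂ hE₃ 0 0
  have hm := mshare_nonneg (L := L) (R := R) hE₂ hE₃ 0
  linarith

/-- **EVERY MERGER SHARE IS AT LEAST `4`** once `n₁ ≥ 1` (`E₂, E₃ ≥ 0`): the summand `4·(n₁ + R_s)` of `mshare` alone.
[folklore] -/
theorem four_le_mshare (hE₂ : 0 ≤ C.E₂) (hE₃ : 0 ≤ C.E₃) (hn : 1 ≤ C.n₁) (s : ℕ) : 4 ≤ mshare C L R s := by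
  unfold mshare dshare
  rw [dictW_merge]
  have hW : (1 : ℝ) ≤ ((C.n₁ + R s : ℕ) : ℝ) := by exact_mod_cast le_add_right hn
  have hwt := T4PrintedShapeBanking.wt_nonneg C ((s, 2, 0) : PEv)
  have h1 : 0 ≤ 8 * ((C.n₁ + R s : ℕ) : ℝ) * ((L : ℝ) * R (PEv.step (s, 2, 0))) ^ C.q' := by positivity
  have h2 : 0 ≤ 8 * (C.E₃ / C.E₂) *
      (((L : ℝ) * R (PEv.step (s, 2, 0))) ^ C.q' * T4PrintedShapeBanking.wt C (s, 2, 0)) := by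
    positivity
  push_cast at hW h1 ⊢
  nlinarith

/-- **IN A VALID CONSTANT TABLE EVERY MERGER SHARE IS POSITIVE** (`C.Valid.dC_le : fatWait dC ≤ n₁` forces `n₁ ≥ 1`):
§2's `not_roundingRoom_face` has its `hm` discharged by the table, not by data. [folklore] -/
theorem mshare_pos_of_valid (hV : C.Valid) (s : ℕ) : 0 < mshare C L R s := by
  have hn : 1 ≤ C.n₁ := le_trans (le_max_left 1 (Nat.log 2 C.dC)) hV.dC_le
  have := four_le_mshare C L R hV.E₂_nonneg hV.E₃_nonneg hn s
  linarith

end Outright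

end

end Summit.QuantumFields.BalabanUV.T4Continuum.B16HistoryStepDisplayValuations
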